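import Summits.Ventures.PercRepro.ThetaOmegaRel

/-!
# The graph form of (Ω): complement-closed families and graphs of independence number ≤ 2

Dossier proofs/MINE1-theoremS.md, Addendum 84 (mine-1, gen 45). The relation form `OmegaRel R` of
`ThetaOmegaRel.lean` counts, for a family `F` with two labellings into a label type carrying a
relation `R`, the meets of `R`-related first slots, the differences of `R`-related first / second
slots and the relative co-joins of `R`-related second slots. Reading the second slot of `s` as the
complement `U \ s` marked by a fresh point, the family of all `2|F|` slots is a COMPLEMENT-CLOSED
family and the three kinds of counted sets are all the meets of related pairs of slots — so the
only structure the bound sees is the graph «related» on the slots. This file records that reading: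

* `Slot`, `topSlot`, `botSlot`, `slotLabel` — the slots `(s, false)` / `(s, true)` of a member and
  the labelling of slots induced by two labellings of members;
* `omegaCountG Γ U F` — **the graph count**: the relation count for a relation `Γ` on the slots
  themselves (`omegaCountG_slotLabel`: the relation count of `(R, l0, l1)` is the graph count of
  the pulled-back graph);
* `TripleRel R` — «among any three labels some ordered pair is related» (for a reflexive symmetric
  `R`: the non-relation graph is triangle-free); `SlotTripleRel Γ F` — the same for the slots of
  `F` (`Γ` has independence number at most two on them);
* `omegaRel_tripleRel` — **necessity**: `OmegaRel α R` forces `TripleRel R` (three members with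
  pairwise unrelated labels count at most `∅`), so with `omegaRel_of_cliqueCover` the relation
  forms that hold are exactly those whose non-relation graph is triangle-free IF the odd-cycle
  cases (the pentagon first) hold;
* `OmegaGraph α` — **Conjecture (Ω_Γ)**, the graph form: every family of at least three members
  and every graph of independence number ≤ 2 on its slots has at least `|F|` meets over the edges;
  `omegaRel_of_omegaGraph` / `omegaGraph_of_omegaRel` — it is equivalent to the relation form
  for every relation with `TripleRel`; `omegaRel_pentR_of_omegaGraph` — it contains (PENT);
* `card_le_omegaCountG_of_bipartite` — the theorem half: a graph whose non-edges on the slots of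
  `F` are bipartite (a 2-colouring of the slots with same-coloured slots adjacent) satisfies the
  bound, by the colouring reduction from (Ω).
-/

namespace PercRepro.MSTight

open Finset

variable {α : Type*} [DecidableEq α] {L : Type*}

section Slots

/-- A **slot** of a family: a member together with a side — `(s, false)` is the first (top) slot
of `s`, `(s, true)` its second (bottom) slot, read as the marked complement of `s`. -/
abbrev Slot (α : Type*) := Finset α × Bool

/-- The first slot of a member. -/
def topSlot (s : Finset α) : Slot α := (s, false)

/-- The second slot of a member. -/
def botSlot (s : Finset α) : Slot α := (s, true)

/-- The labelling of slots induced by two labellings of members: the first slot of `s` carries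
`l0 s`, the second `l1 s`. -/
def slotLabel (l0 l1 : Finset α → L) (u : Slot α) : L := bif u.2 then l1 u.1 else l0 u.1

omit [DecidableEq α] in
/-- The first slot of `s` carries `l0 s`. -/
@[simp] theorem slotLabel_topSlot (l0 l1 : Finset α → L) (s : Finset α) :
    slotLabel l0 l1 (topSlot s) = l0 s := rfl

omit [DecidableEq α] in
/-- The second slot of `s` carries `l1 s`. -/
@[simp] theorem slotLabel_botSlot (l0 l1 : Finset α → L) (s : Finset α) :
    slotLabel l0 l1 (botSlot s) = l1 s := rfl

omit [DecidableEq α] in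
/-- A first slot is never a second slot. -/
theorem topSlot_ne_botSlot (s t : Finset α) : topSlot s ≠ botSlot t := by
  intro h
  have := congrArg Prod.snd h
  simp [topSlot, botSlot] at this

omit [DecidableEq α] in
/-- Distinct members have distinct first slots. -/
theorem topSlot_injective : Function.Injective (topSlot (α := α)) := fun _ _ h =>
  congrArg Prod.fst h

omit [DecidableEq α] in
/-- Distinct members have distinct second slots. -/
theorem botSlot_injective : Function.Injective (botSlot (α := α)) := fun _ _ h =>
  congrArg Prod.fst h

end Slots

section GraphCount

/-- **The graph count**: the relation count of a relation `Γ` on the slots themselves — the meets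
of distinct members whose first slots are `Γ`-related, the differences `s \ t` whose first / second
slots are `Γ`-related (`s = t` allowed), the relative co-joins of distinct members whose second
slots are `Γ`-related. -/
def omegaCountG (Γ : Slot α → Slot α → Prop) [DecidableRel Γ] (U : Finset α)
    (F : Finset (Finset α)) : ℕ :=
  omegaCountR Γ U F topSlot botSlot

/-- «Among any three labels some ordered pair is related»: for a reflexive symmetric relation,
the non-relation graph has no triangle (and no loop). -/
def TripleRel (R : L → L → Prop) : Prop :=
  ∀ a b c : L, R a b ∨ R b a ∨ R a c ∨ R c a ∨ R b c ∨ R c b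

/-- «Among any three distinct slots of `F` some ordered pair is `Γ`-related»: `Γ` has independence
number at most two on the slots of `F`. -/
def SlotTripleRel (Γ : Slot α → Slot α → Prop) (F : Finset (Finset α)) : Prop :=
  ∀ u v w : Slot α, u.1 ∈ F → v.1 ∈ F → w.1 ∈ F → u ≠ v → u ≠ w → v ≠ w →
    Γ u v ∨ Γ v u ∨ Γ u w ∨ Γ w u ∨ Γ v w ∨ Γ w v

/-- **Conjecture (Ω_Γ), the graph form**: every family of at least three subsets of a ground set,
with any graph of independence number at most two on its `2|F|` slots, has at least `|F|` meets
over the edges of the graph (the meets of first slots, the differences, the marked co-joins). -/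
def OmegaGraph (α : Type*) [DecidableEq α] : Prop :=
  ∀ (U : Finset α) (F : Finset (Finset α)) (Γ : Slot α → Slot α → Prop) [DecidableRel Γ],
    (∀ s ∈ F, s ⊆ U) → 3 ≤ F.card → SlotTripleRel Γ F → F.card ≤ omegaCountG Γ U F

variable {R : L → L → Prop} [DecidableRel R] {U : Finset α} {F : Finset (Finset α)}
  {l0 l1 : Finset α → L}

/-- The relation `A`-family of `(R, l0, l1)` is the `A`-family of the pulled-back slot relation. -/
theorem omegaAR_slotLabel :
    omegaAR (fun u v => R (slotLabel l0 l1 u) (slotLabel l0 l1 v)) F topSlot botSlot =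
      omegaAR R F l0 l1 := by
  ext E
  simp only [mem_omegaAR, slotLabel_topSlot, slotLabel_botSlot]

/-- The relation `C`-family of `(R, l1)` is the `C`-family of the pulled-back slot relation. -/
theorem omegaCR_slotLabel :
    omegaCR (fun u v => R (slotLabel l0 l1 u) (slotLabel l0 l1 v)) U F botSlot =
      omegaCR R U F l1 := by
  ext E
  simp only [mem_omegaCR, slotLabel_botSlot]

/-- **The relation count is a graph count**: pulling `R` back along the slot labelling. -/
theorem omegaCountG_slotLabel :
    omegaCountG (fun u v => R (slotLabel l0 l1 u) (slotLabel l0 l1 v)) U F =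
      omegaCountR R U F l0 l1 := by
  unfold omegaCountG omegaCountR
  rw [omegaAR_slotLabel, omegaCR_slotLabel]

omit [DecidableEq α] [DecidableRel R] in
/-- A relation with `TripleRel` pulls back to a slot relation with `SlotTripleRel`. -/
theorem slotTripleRel_of_tripleRel (hR : TripleRel R) (l0 l1 : Finset α → L) :
    SlotTripleRel (fun u v => R (slotLabel l0 l1 u) (slotLabel l0 l1 v)) F :=
  fun u v w _ _ _ _ _ _ => hR (slotLabel l0 l1 u) (slotLabel l0 l1 v) (slotLabel l0 l1 w)

end GraphCount

section Necessity

variable {R : L → L → Prop} [DecidableRel R]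

/-- The three-member witness family `{∅, {x}, {y}}`. -/
theorem card_three_family {x y : α} (hxy : x ≠ y) :
    ({∅, {x}, {y}} : Finset (Finset α)).card = 3 := by
  rw [card_insert_of_notMem, card_insert_of_notMem, card_singleton]
  · rw [mem_singleton]
    exact fun h => hxy (singleton_inj.1 h)
  · simp only [mem_insert, mem_singleton, not_or]
    exact ⟨(singleton_ne_empty x).symm, (singleton_ne_empty y).symm⟩

/-- **Necessity of the triple condition**: if the relation form holds (on a type with two distinct
points), then among any three labels some ordered pair is related — three members labelled
`a, b, c` on both slots with no related ordered pair count at most `∅`. -/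
theorem omegaRel_tripleRel {x y : α} (hxy : x ≠ y) (h : OmegaRel α R) : TripleRel R := by
  intro a b c
  by_contra hn
  simp only [not_or] at hn
  obtain ⟨hab, hba, hac, hca, hbc, hcb⟩ := hn
  -- the witness: `∅ ↦ a`, `{x} ↦ b`, `{y} ↦ c` on both slots
  obtain ⟨l, hl⟩ : ∃ l : Finset α → L, l = fun s => if s = ∅ then a else if s = {x} then b else c :=
    ⟨_, rfl⟩
  obtain ⟨F, hF⟩ : ∃ F : Finset (Finset α), F = {∅, {x}, {y}} := ⟨_, rfl⟩
  have hl0 : l ∅ = a := by rw [hl]; simp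
  have hl1 : l {x} = b := by
    rw [hl]
    simp only [singleton_ne_empty, if_false, if_true]
  have hl2 : l {y} = c := by
    rw [hl]
    simp only [singleton_ne_empty, if_false]
    rw [if_neg]
    intro h'
    exact hxy (singleton_inj.1 h').symm
  -- two distinct members of `F` never carry a related ordered pair of labels
  have key : ∀ s ∈ F, ∀ t ∈ F, s ≠ t → ¬ R (l s) (l t) := by
    intro s hs t ht hst
    simp only [hF, mem_insert, mem_singleton] at hs ht
    rcases hs with rfl | rfl | rfl <;> rcases ht with rfl | rfl | rfl <;>
      first
      | exact absurd rfl hst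
      | (rw [hl0, hl1]; exact hab) | (rw [hl1, hl0]; exact hba)
      | (rw [hl0, hl2]; exact hac) | (rw [hl2, hl0]; exact hca)
      | (rw [hl1, hl2]; exact hbc) | (rw [hl2, hl1]; exact hcb)
  have hA : omegaAR R F l l ⊆ {∅} := by
    intro E hE
    rw [mem_singleton]
    rcases mem_omegaAR.1 hE with ⟨s, hs, t, ht, hst, hr, rfl⟩ | ⟨s, hs, t, ht, hr, rfl⟩
    · exact absurd hr (key s hs t ht hst)
    · by_cases hst : s = t
      · subst hst; exact Finset.sdiff_self s
      · exact absurd hr (key s hs t ht hst)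
  have hC : omegaCR R {x, y} F l = ∅ := by
    rw [eq_empty_iff_forall_notMem]
    intro E hE
    obtain ⟨s, hs, t, ht, hst, hr, -⟩ := mem_omegaCR.1 hE
    exact key s hs t ht hst hr
  have hsub : ∀ s ∈ F, s ⊆ ({x, y} : Finset α) := by
    intro s hs
    simp only [hF, mem_insert, mem_singleton] at hs
    rcases hs with rfl | rfl | rfl
    · exact empty_subset _
    · exact singleton_subset_iff.2 (mem_insert_self x {y})
    · exact singleton_subset_iff.2 (mem_insert_of_mem (mem_singleton_self y))
  have h3 : F.card = 3 := by rw [hF]; exact card_three_family hxy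
  have hcount := h {x, y} F l l hsub (by omega)
  unfold omegaCountR at hcount
  have hAc : (omegaAR R F l l).card ≤ 1 := by
    simpa using card_le_card hA
  rw [hC, card_empty] at hcount
  omega

end Necessity

section Equivalence

variable {R : L → L → Prop} [DecidableRel R]

/-- **The graph form gives every relation form with the triple condition.** -/
theorem omegaRel_of_omegaGraph (hG : OmegaGraph α) (hR : TripleRel R) : OmegaRel α R := by
  intro U F l0 l1 hF h3
  have := hG U F (fun u v => R (slotLabel l0 l1 u) (slotLabel l0 l1 v)) hF h3
    (slotTripleRel_of_tripleRel hR l0 l1)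
  rwa [omegaCountG_slotLabel] at this

variable {Γ : Slot α → Slot α → Prop} [DecidableRel Γ] {U : Finset α} {F : Finset (Finset α)}

/-- The reflexive closure of `Γ` relative to `F`: related outside the slots of `F` and on the
diagonal, `Γ` otherwise (an `abbrev`, so that it is decidable when `Γ` is). -/
abbrev slotRelOn (Γ : Slot α → Slot α → Prop) (F : Finset (Finset α)) (u v : Slot α) : Prop :=
  u = v ∨ u.1 ∉ F ∨ v.1 ∉ F ∨ Γ u v

omit [DecidableEq α] [DecidableRel Γ] in
/-- On two distinct slots of `F` the relative closure is `Γ` itself. -/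
theorem slotRelOn_iff {u v : Slot α} (hu : u.1 ∈ F) (hv : v.1 ∈ F) (huv : u ≠ v) :
    slotRelOn Γ F u v ↔ Γ u v := by
  unfold slotRelOn
  constructor
  · rintro (h | h | h | h)
    · exact absurd h huv
    · exact absurd hu h
    · exact absurd hv h
    · exact h
  · exact fun h => Or.inr (Or.inr (Or.inr h))

omit [DecidableRel Γ] in
/-- The relative closure of a graph with `SlotTripleRel` on `F` has `TripleRel` on all slots. -/
theorem tripleRel_slotRelOn (hT : SlotTripleRel Γ F) : TripleRel (slotRelOn Γ F) := by
  intro u v w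
  by_cases huv : u = v
  · exact Or.inl (Or.inl huv)
  by_cases huw : u = w
  · exact Or.inr (Or.inr (Or.inl (Or.inl huw)))
  by_cases hvw : v = w
  · exact Or.inr (Or.inr (Or.inr (Or.inr (Or.inl (Or.inl hvw)))))
  by_cases hu : u.1 ∈ F
  swap
  · exact Or.inl (Or.inr (Or.inl hu))
  by_cases hv : v.1 ∈ F
  swap
  · exact Or.inl (Or.inr (Or.inr (Or.inl hv)))
  by_cases hw : w.1 ∈ F
  swap
  · exact Or.inr (Or.inr (Or.inl (Or.inr (Or.inr (Or.inl hw)))))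
  rcases hT u v w hu hv hw huv huw hvw with h | h | h | h | h | h
  · exact Or.inl ((slotRelOn_iff hu hv huv).2 h)
  · exact Or.inr (Or.inl ((slotRelOn_iff hv hu (Ne.symm huv)).2 h))
  · exact Or.inr (Or.inr (Or.inl ((slotRelOn_iff hu hw huw).2 h)))
  · exact Or.inr (Or.inr (Or.inr (Or.inl ((slotRelOn_iff hw hu (Ne.symm huw)).2 h))))
  · exact Or.inr (Or.inr (Or.inr (Or.inr (Or.inl ((slotRelOn_iff hv hw hvw).2 h)))))
  · exact Or.inr (Or.inr (Or.inr (Or.inr (Or.inr ((slotRelOn_iff hw hv (Ne.symm hvw)).2 h)))))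

/-- The `A`-family does not see the relative closure. -/
theorem omegaAR_slotRelOn :
    omegaAR (slotRelOn Γ F) F topSlot botSlot = omegaAR Γ F topSlot botSlot := by
  ext E
  rw [mem_omegaAR, mem_omegaAR]
  constructor
  · rintro (⟨s, hs, t, ht, hst, hr, rfl⟩ | ⟨s, hs, t, ht, hr, rfl⟩)
    · exact Or.inl ⟨s, hs, t, ht, hst,
        (slotRelOn_iff hs ht (fun h => hst (topSlot_injective h))).1 hr, rfl⟩
    · exact Or.inr ⟨s, hs, t, ht, (slotRelOn_iff hs ht (topSlot_ne_botSlot s t)).1 hr, rfl⟩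
  · rintro (⟨s, hs, t, ht, hst, hr, rfl⟩ | ⟨s, hs, t, ht, hr, rfl⟩)
    · exact Or.inl ⟨s, hs, t, ht, hst,
        (slotRelOn_iff hs ht (fun h => hst (topSlot_injective h))).2 hr, rfl⟩
    · exact Or.inr ⟨s, hs, t, ht, (slotRelOn_iff hs ht (topSlot_ne_botSlot s t)).2 hr, rfl⟩

/-- The `C`-family does not see the relative closure. -/
theorem omegaCR_slotRelOn :
    omegaCR (slotRelOn Γ F) U F botSlot = omegaCR Γ U F botSlot := by
  ext E
  rw [mem_omegaCR, mem_omegaCR]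
  constructor
  · rintro ⟨s, hs, t, ht, hst, hr, rfl⟩
    exact ⟨s, hs, t, ht, hst,
      (slotRelOn_iff hs ht (fun h => hst (botSlot_injective h))).1 hr, rfl⟩
  · rintro ⟨s, hs, t, ht, hst, hr, rfl⟩
    exact ⟨s, hs, t, ht, hst,
      (slotRelOn_iff hs ht (fun h => hst (botSlot_injective h))).2 hr, rfl⟩

/-- **Every relation form with the triple condition gives the graph form**: a graph on the slots
is the relation form for the label type `Slot α` with its reflexive closure relative to `F`. -/
theorem omegaGraph_of_omegaRel
    (h : ∀ (R : Slot α → Slot α → Prop) [DecidableRel R], TripleRel R → OmegaRel α R) :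
    OmegaGraph α := by
  intro U F Γ _ hF h3 hT
  have := h (slotRelOn Γ F) (tripleRel_slotRelOn hT) U F topSlot botSlot hF h3
  unfold omegaCountG omegaCountR
  unfold omegaCountR at this
  rwa [omegaAR_slotRelOn, omegaCR_slotRelOn] at this

/-- **The theorem half of the graph form**: if the slots of `F` can be 2-coloured so that two
distinct same-coloured slots are always `Γ`-related (the non-edges of `Γ` on the slots of `F` form a
bipartite graph), the bound holds — the colouring reduction from (Ω). -/
theorem card_le_omegaCountG_of_bipartite (hF : ∀ s ∈ F, s ⊆ U) (h3 : 3 ≤ F.card)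
    (χ : Slot α → Bool)
    (hχ : ∀ u v : Slot α, u.1 ∈ F → v.1 ∈ F → u ≠ v → χ u = χ v → Γ u v) :
    F.card ≤ omegaCountG Γ U F :=
  card_le_omegaCountR_of_colouring (φ0 := fun s => χ (topSlot s)) (φ1 := fun s => χ (botSlot s))
    hF h3
    (fun _ hs _ ht hst h => hχ _ _ hs ht (fun h' => hst (topSlot_injective h')) h)
    (fun s hs t ht h => hχ _ _ hs ht (topSlot_ne_botSlot s t) h)
    (fun _ hs _ ht hst h => hχ _ _ hs ht (fun h' => hst (botSlot_injective h')) h)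

end Equivalence

section PentagonGraph

/-- The pentagon relation satisfies the triple condition: its non-relation graph `C₅` has no
triangle. -/
theorem pentR_tripleRel : TripleRel pentR := by
  unfold TripleRel pentR
  decide

/-- **(PENT) is an instance of the graph form**: the graph form gives `OmegaRel α pentR`
(= `OmegaPentagon α`, the kernel Prop of row C-050). -/
theorem omegaRel_pentR_of_omegaGraph (hG : OmegaGraph α) : OmegaRel α pentR :=
  omegaRel_of_omegaGraph hG pentR_tripleRel

end PentagonGraph

end PercRepro.MSTight
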